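import Mathlib.Algebra.Lie.InvariantForm
import HarnessLib

/-!
# An invariant bilinear form on a simple Lie algebra is zero or non-degenerate

Topic `Literature/Algebra/Lie`. Theorems only (no definition, no named fact, D-0026), Mathlib vocabulary
(`LieAlgebra.IsSimple`, `LinearMap.BilinForm.lieInvariant`, `LieAlgebra.InvariantForm.orthogonal`). Written for the
cell `pub-hodgecm2` (COR-CM), seat `b27`, count-neutral own lane MT-RANK-SEVEN-TYPEIII, where it is applied to RATIONAL
invariant forms (`8 · tr_V(XY) − dim V · κ(X, Y)`, `dim V · tr_V(zXY) − tr z · tr_V(XY)`) on the `ℚ`-simple Hodge Lie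
algebra of an abelian variety: such a form vanishes as soon as it is degenerate, and degeneracy can be tested after
extension of scalars to `ℂ`.

PRINTED RESULT. The radical `{x : Φ(L, x) = 0}` of an invariant bilinear form `Φ` on a Lie algebra `L` is an ideal
(J. E. Humphreys, GTM 9, §5.1, the argument for the Killing form; J. Dieudonné's criterion, Mathlib
`LieAlgebra.InvariantForm.orthogonal`); hence on a SIMPLE `L` an invariant form is either zero or has trivial radical
(N. Jacobson, *Lie Algebras*, Ch. III §4–§5; Humphreys §5.1 and Ex. 6.1).

* `eq_zero_of_isSimple_of_orthogonal` — `L` simple, `Φ` invariant, some `x ≠ 0` with `Φ(y, x) = 0` for all `y`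
  ⟹ `Φ = 0`.
* `separatingRight_of_isSimple_of_ne_zero` / `nondegenerate_of_isSimple_of_ne_zero` — `L` simple, `Φ ≠ 0` invariant
  (and reflexive, for two-sided non-degeneracy) ⟹ `Φ` non-degenerate.

## References

* [Humphreys1972] J. E. Humphreys, *Introduction to Lie Algebras and Representation Theory*, GTM 9 (1972), §5.1.
* [Jacobson1962LieAlgebras] N. Jacobson, *Lie Algebras* (1962), Ch. III §4–§5.
-/

namespace Literature.Algebra.Lie

namespace InvariantFormSimple

open LieAlgebra

variable {K : Type*} [Field K] {L : Type*} [LieRing L] [LieAlgebra K L]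

/-- **An invariant bilinear form on a simple Lie algebra with a non-zero right-radical vector vanishes**: the right
radical `{x : ∀ y, Φ y x = 0}` is a Lie ideal (`LieAlgebra.InvariantForm.orthogonal Φ _ ⊤`), non-zero by hypothesis,
hence everything. [cite: Humphreys1972, §5.1] [cite: Jacobson1962LieAlgebras, Ch. III §4] -/
theorem eq_zero_of_isSimple_of_orthogonal [LieAlgebra.IsSimple K L] {Φ : LinearMap.BilinForm K L}
    (hΦ : Φ.lieInvariant L) {x : L} (hx : x ≠ 0) (hrad : ∀ y : L, Φ y x = 0) : Φ = 0 := by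
  set R : LieIdeal K L := LieAlgebra.InvariantForm.orthogonal Φ hΦ ⊤ with hR
  have hxR : x ∈ R := by
    rw [hR, LieAlgebra.InvariantForm.mem_orthogonal]
    exact fun y _ => hrad y
  have hRtop : R = ⊤ := by
    rcases LieAlgebra.IsSimple.eq_bot_or_eq_top R with h | h
    · exfalso
      rw [h] at hxR
      exact hx ((LieSubmodule.mem_bot x).1 hxR)
    · exact h
  refine LinearMap.ext fun y => LinearMap.ext fun z => ?_
  have hz : z ∈ R := by rw [hRtop]; exact LieSubmodule.mem_top z
  rw [hR, LieAlgebra.InvariantForm.mem_orthogonal] at hz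
  rw [LinearMap.zero_apply, LinearMap.zero_apply]
  exact hz y (LieSubmodule.mem_top y)

/-- Contrapositive: a NON-ZERO invariant form on a simple Lie algebra is right-separating (`Φ(L, x) = 0 ⟹ x = 0`).
[cite: Humphreys1972, §5.1] [cite: Jacobson1962LieAlgebras, Ch. III §4] -/
theorem separatingRight_of_isSimple_of_ne_zero [LieAlgebra.IsSimple K L] {Φ : LinearMap.BilinForm K L}
    (hΦ : Φ.lieInvariant L) (h0 : Φ ≠ 0) : LinearMap.SeparatingRight Φ := by
  intro x hx
  by_contra hne
  exact h0 (eq_zero_of_isSimple_of_orthogonal hΦ hne hx)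

/-- **A non-zero REFLEXIVE invariant form on a simple Lie algebra is non-degenerate** (both radicals vanish).
[cite: Humphreys1972, §5.1] [cite: Jacobson1962LieAlgebras, Ch. III §4] -/
theorem nondegenerate_of_isSimple_of_ne_zero [LieAlgebra.IsSimple K L] {Φ : LinearMap.BilinForm K L}
    (hΦ : Φ.lieInvariant L) (hrefl : Φ.IsRefl) (h0 : Φ ≠ 0) : Φ.Nondegenerate := by
  have hR := separatingRight_of_isSimple_of_ne_zero hΦ h0
  refine ⟨fun x hx => hR x fun y => hrefl x y (hx y), hR⟩

end InvariantFormSimple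

end Literature.Algebra.Lie
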